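import Literature.Probability.RandomPlanarGeometry.SAWPulledLargeForceExpansionZdLinearRadius
import Literature.Probability.RandomPlanarGeometry.SAWPulledLargeForceExpansionZdFirstOrder
import HarnessLib

/-!
# The pulled-bridge free energy on `ℤ^{d+1}` is below its first-order expansion: `y ≤ e^{λ_B(y)} ≤ y + 2d` for every `y ≥ 1`

Topic `Literature/Probability/RandomPlanarGeometry` (continues `SAWPulledLargeForceExpansionZdLinearRadius.lean`: the
one-step extension bookkeeping `sum_saws_succ_eq_sum_freeNbrs` over `BDGS2012CountMonoExt` (`unitSteps`, `nbrs`,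
`freeNbrs`, `extendTo`), and, through its imports, `pulledBridgeZ (d+1) n y = Z^B_n(y) = Σ_{bridges} y^{span}`
(`SAWPulledFreeEnergyZ2.pulledBridgeZ_eq_sum_bridges`); `SAWPulledLargeForceExpansionZdFirstOrder.lean`:
`largeForceCoeffZd_at_one : c_1^{(d)} = 2d`; the pulled-bridge free energy
`pulledBridgeFreeEnergy (d+1) y = λ_B(y) = lim n⁻¹ log Z^B_n(y)` with the Fekete transfer
`pulledBridgeFreeEnergy_le_log_of_geometric` and `log_le_pulledBridgeFreeEnergy_zd` (`λ_B ≥ log y`)).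

The large-force expansion `e^{λ_B(y)} = y + 2d − 2d/y + 2d(2d+1)/y² − …` of the tree (`SAWPulledLargeForceExpansionZd*`)
comes with asymptotic remainders (`exp_pulledBridgeFreeEnergy_first_order_zd`: `|e^{λ_B(y)} − (y + 2d)| ≤ C/y` for `y ≥ y₁`,
non-explicit `C, y₁`).  This file proves the GLOBAL, explicit, dimension-uniform envelope

  ★★ `exp_pulledBridgeFreeEnergy_le_add : e^{λ_B(y)} ≤ y + 2d` for every `y ≥ 1` and every `d`

(so `0 ≤ e^{λ_B(y)} − y ≤ 2d = c_1^{(d)}`: the first-order truncation of the large-force expansion is an upper bound at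
ALL forces `y ≥ 1`), by a memory-one tilted count: for an `n`-step self-avoiding walk `ω` (`n ≥ 1`) the tilted weight
`Σ_{y'} y^{y'·e₀}` of its free one-step extensions `y'` is at most `(y + 2d)·y^{ω(n)·e₀}` when `y ≥ 1`, because among the
`2d + 2` lattice neighbours of `ω(n)` (total tilted weight `(y + 2d + y⁻¹)·y^{ω(n)·e₀}`, `sum_nbrs_zpow_eq`) the previous
site `ω(n−1)` is occupied and carries weight `≥ y⁻¹·y^{ω(n)·e₀}` (`sum_freeNbrs_zpow_le`).  Hence

* ★ `sum_saws_zpow_le : Σ_{ω ∈ SAW_{n+1}(ℤ^{d+1})} y^{ω(n+1)·e₀} ≤ (y + 2d + y⁻¹)(y + 2d)ⁿ` and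
  `sum_saws_zpow_le_two_mul : Σ_{ω ∈ SAW_n} y^{ω(n)·e₀} ≤ 2(y + 2d)ⁿ` (`y ≥ 1`) — the endpoint-pulled self-avoiding-walk
  partition function in every dimension;
* `pulledBridgeZ_le_two_mul_pow : Z^B_n(y) ≤ 2(y + 2d)ⁿ`; ★★ `pulledBridgeFreeEnergy_le_log_add : λ_B(y) ≤ log(y + 2d)`;
  ★★ `exp_pulledBridgeFreeEnergy_mem_Icc : e^{λ_B(y)} ∈ [y, y + 2d]`, `exp_pulledBridgeFreeEnergy_sub_le_largeForceCoeffZd_one :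
  e^{λ_B(y)} − y ≤ c_1^{(d)}` (`y ≥ 1`, every `d`).

Printed status: Janse van Rensburg–Whittington (2013, §3.2 eq. (3.12)) print `max{log μ_d, log y} ≤ λ(y) ≤ log μ_d + log y`;
the bound `λ_B(y) ≤ log(y + 2d)`, sharp to first order as `y → ∞`, is to our knowledge not in print for `d + 1 ≥ 3` (the
tree has the planar `λ_B(y) ≤ log(y + 2)`, `SAWAdsorptionPulledBoundary.pulledBridgeFreeEnergy_le_log_add_two`, by a transfer
potential; the present proof is the dimension-free one-step version of that argument).  Provenance: lane «pcv-sawmu», a-p3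
g26 (2026-08-28).  PURE STD, no data, no `decide`.
-/

noncomputable section

open Finset Filter Topology
open scoped BigOperators
open Literature.Probability.LatticeModels
open Literature.Probability.RandomPlanarGeometry.SAW

namespace Literature.Probability.RandomPlanarGeometry.SAW.Zd

/-! ### Tilted weights of the neighbours of a site -/

/-- **The one-step tilted weight sum**: `Σ_{v ∈ unitSteps(ℤ^{d+1})} y^{v·e₀} = y + 2d + y⁻¹` (`y ≠ 0`; integer powers).
[cite: JansevanRensburgWhittington2013, §3.2 eq. (3.12) (arXiv v4 p. 9)] -/
theorem sum_unitSteps_zpow_eq (d : ℕ) (y : ℝ) :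
    ∑ v ∈ unitSteps (d + 1), y ^ (v 0) = y + 2 * d + y⁻¹ := by
  classical
  rw [unitSteps, Finset.sum_image]
  · rw [Fintype.sum_prod_type, Fin.sum_univ_succ]
    have hzero : (∑ b : Bool, y ^ ((if b then (Pi.single (0 : Fin (d + 1)) (1 : ℤ) : Site (d + 1))
        else -(Pi.single (0 : Fin (d + 1)) (1 : ℤ) : Site (d + 1))) 0)) = y + y⁻¹ := by
      simp
    have hsucc : ∀ j : Fin d, (∑ b : Bool, y ^ ((if b then (Pi.single (Fin.succ j) (1 : ℤ) : Site (d + 1))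
        else -(Pi.single (Fin.succ j) (1 : ℤ) : Site (d + 1))) 0)) = 1 + 1 := by
      intro j; simp
    rw [hzero, Finset.sum_congr rfl fun j _ => hsucc j, Finset.sum_const, Finset.card_univ, Fintype.card_fin,
      nsmul_eq_mul]
    ring
  · rintro ⟨k, b⟩ - ⟨k', b'⟩ - h
    have hk : k = k' := by
      by_contra hne
      have := congrFun h k
      cases b <;> cases b' <;> simp [Pi.single_eq_of_ne hne] at this
    subst hk
    cases b <;> cases b' <;> first | rfl | (exfalso; have := congrFun h k; simp at this)

/-- The tilted weight sum over ALL lattice neighbours of a site `x`: `Σ_{y' ~ x} y^{y'·e₀} = y^{x·e₀}·(y + 2d + y⁻¹)`.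
[cite: JansevanRensburgWhittington2013, §3.2 eq. (3.12) (arXiv v4 p. 9)] -/
theorem sum_nbrs_zpow_eq {d : ℕ} (x : Site (d + 1)) {y : ℝ} (hy : y ≠ 0) :
    ∑ y' ∈ nbrs x, y ^ (y' 0) = y ^ (x 0) * (y + 2 * d + y⁻¹) := by
  classical
  rw [nbrs, Finset.sum_image (add_right_injective x).injOn, ← sum_unitSteps_zpow_eq d y, Finset.mul_sum]
  refine Finset.sum_congr rfl fun v _ => ?_
  rw [Pi.add_apply, zpow_add₀ hy]

/-- **The memory-one step**: for an `(n+1)`-step self-avoiding walk `ω` on `ℤ^{d+1}` and `y ≥ 1`, the tilted weight of its free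
one-step extensions is at most `(y + 2d)·y^{ω(n+1)·e₀}` — the `2d + 2` neighbours of the endpoint weigh `(y + 2d + y⁻¹)·y^{ω(n+1)·e₀}`
and the previous site `ω(n)` (occupied, adjacent, force coordinate within `1`) weighs at least `y⁻¹·y^{ω(n+1)·e₀}`.
[cite: JansevanRensburgWhittington2013, §3.2 eq. (3.12) (arXiv v4 p. 9)] [cite: MadrasSlade1993, §1.1, eq. (1.1.1)] -/
theorem sum_freeNbrs_zpow_le {d n : ℕ} {ω : ℕ → Site (d + 1)} (hω : ω ∈ saws (d + 1) (n + 1)) {y : ℝ} (hy : 1 ≤ y) :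
    ∑ y' ∈ freeNbrs ω (n + 1), y ^ (y' 0) ≤ (y + 2 * d) * y ^ (ω (n + 1) 0) := by
  classical
  have hy0 : 0 < y := zero_lt_one.trans_le hy
  obtain ⟨-, -, hadj, -⟩ := mem_saws.1 hω
  have had : (zdGraph (d + 1)).Adj (ω n) (ω (n + 1)) := hadj n (Nat.lt_succ_self n)
  have hprev : ω n ∈ nbrs (ω (n + 1)) := mem_nbrs.2 had.symm
  have hnot : ω n ∉ freeNbrs ω (n + 1) := fun h => (mem_freeNbrs.1 h).2 n (Nat.le_succ n) rfl
  have hsub : freeNbrs ω (n + 1) ⊆ (nbrs (ω (n + 1))).erase (ω n) := fun y' hy' =>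
    Finset.mem_erase.2 ⟨fun h => hnot (h ▸ hy'), Finset.filter_subset _ _ hy'⟩
  have h1 : ∑ y' ∈ freeNbrs ω (n + 1), y ^ (y' 0) ≤ ∑ y' ∈ (nbrs (ω (n + 1))).erase (ω n), y ^ (y' 0) :=
    Finset.sum_le_sum_of_subset_of_nonneg hsub fun y' _ _ => (zpow_pos hy0 _).le
  rw [Finset.sum_erase_eq_sub hprev, sum_nbrs_zpow_eq _ hy0.ne'] at h1
  -- the previous site has force coordinate `ω(n+1)·e₀ − δ`, `δ ∈ {−1, 0, 1}`
  have hδ := abs_sub_le_one_of_adj had 0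
  set h : ℤ := ω (n + 1) 0 with hh
  have hP : 0 < y ^ h := zpow_pos hy0 _
  have hyi : y⁻¹ ≤ 1 := inv_le_one_of_one_le₀ hy
  have hcase : ω n 0 = h + 1 ∨ ω n 0 = h ∨ ω n 0 = h + (-1) := by
    rcases abs_le.1 hδ with ⟨h₁, h₂⟩; omega
  have hlow : y ^ h * y⁻¹ ≤ y ^ (ω n 0) := by
    rcases hcase with e | e | e <;> rw [e]
    · rw [zpow_add₀ hy0.ne', zpow_one]; exact mul_le_mul_of_nonneg_left (hyi.trans hy) hP.le
    · exact mul_le_of_le_one_right hP.le hyi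
    · rw [zpow_add₀ hy0.ne', zpow_neg_one]
  calc ∑ y' ∈ freeNbrs ω (n + 1), y ^ (y' 0) ≤ y ^ h * (y + 2 * d + y⁻¹) - y ^ (ω n 0) := h1
    _ ≤ y ^ h * (y + 2 * d + y⁻¹) - y ^ h * y⁻¹ := by linarith
    _ = (y + 2 * d) * y ^ h := by ring

/-! ### The endpoint-pulled partition functions are at most `2(y + 2d)ⁿ` -/

/-- ★ **`Σ_{ω ∈ SAW_{n+1}(ℤ^{d+1})} y^{ω(n+1)·e₀} ≤ (y + 2d + y⁻¹)·(y + 2d)ⁿ`** for every `y ≥ 1` (induction over one-step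
extensions with the memory-one step; the first step weighs `y + 2d + y⁻¹`). [cite: JansevanRensburgWhittington2013, §3.2 eq. (3.12) (arXiv v4 p. 9)] -/
theorem sum_saws_zpow_le (d : ℕ) {y : ℝ} (hy : 1 ≤ y) :
    ∀ n : ℕ, ∑ ω ∈ saws (d + 1) (n + 1), y ^ (ω (n + 1) 0) ≤ (y + 2 * d + y⁻¹) * (y + 2 * d) ^ n
  | 0 => by
    classical
    have hy0 : 0 < y := zero_lt_one.trans_le hy
    rw [pow_zero, mul_one, sum_saws_succ_eq_sum_freeNbrs]
    simp only [extendTo_of_lt (Nat.lt_succ_self 0)]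
    have hω0 : ∀ ω ∈ saws (d + 1) 0, ∑ y' ∈ freeNbrs ω 0, y ^ (y' 0) ≤ y + 2 * d + y⁻¹ := by
      intro ω hω
      have h0 : ω 0 = 0 := (mem_saws.1 hω).1
      calc ∑ y' ∈ freeNbrs ω 0, y ^ (y' 0) ≤ ∑ y' ∈ nbrs (ω 0), y ^ (y' 0) :=
            Finset.sum_le_sum_of_subset_of_nonneg (Finset.filter_subset _ _) fun y' _ _ => (zpow_pos hy0 _).le
        _ = y + 2 * d + y⁻¹ := by rw [sum_nbrs_zpow_eq _ hy0.ne', h0, Pi.zero_apply, zpow_zero, one_mul]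
    calc ∑ ω ∈ saws (d + 1) 0, ∑ y' ∈ freeNbrs ω 0, y ^ (y' 0) ≤ ∑ _ω ∈ saws (d + 1) 0, (y + 2 * d + y⁻¹) :=
          Finset.sum_le_sum hω0
      _ = y + 2 * d + y⁻¹ := by rw [Finset.sum_const, card_saws, count_zero]; simp
  | n + 1 => by
    classical
    have hy0 : 0 < y := zero_lt_one.trans_le hy
    have hK : 0 ≤ y + 2 * (d : ℝ) := by positivity
    rw [sum_saws_succ_eq_sum_freeNbrs]
    simp only [extendTo_of_lt (Nat.lt_succ_self (n + 1))]
    calc ∑ ω ∈ saws (d + 1) (n + 1), ∑ y' ∈ freeNbrs ω (n + 1), y ^ (y' 0)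
        ≤ ∑ ω ∈ saws (d + 1) (n + 1), (y + 2 * d) * y ^ (ω (n + 1) 0) :=
          Finset.sum_le_sum fun ω hω => sum_freeNbrs_zpow_le hω hy
      _ = (y + 2 * d) * ∑ ω ∈ saws (d + 1) (n + 1), y ^ (ω (n + 1) 0) := by rw [Finset.mul_sum]
      _ ≤ (y + 2 * d) * ((y + 2 * d + y⁻¹) * (y + 2 * d) ^ n) := mul_le_mul_of_nonneg_left (sum_saws_zpow_le d hy n) hK
      _ = (y + 2 * d + y⁻¹) * (y + 2 * d) ^ (n + 1) := by ring

/-- ★ **The endpoint-pulled self-avoiding-walk partition function in every dimension**: `Σ_{ω ∈ SAW_n(ℤ^{d+1})} y^{ω(n)·e₀} ≤ 2(y + 2d)ⁿ`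
for every `y ≥ 1` and every `n` (`y + 2d + y⁻¹ ≤ 2(y + 2d)`). [cite: JansevanRensburgWhittington2013, §3.2 eq. (3.12) (arXiv v4 p. 9)] -/
theorem sum_saws_zpow_le_two_mul (d n : ℕ) {y : ℝ} (hy : 1 ≤ y) :
    ∑ ω ∈ saws (d + 1) n, y ^ (ω n 0) ≤ 2 * (y + 2 * d) ^ n := by
  have hy0 : 0 < y := zero_lt_one.trans_le hy
  rcases n with _ | n
  · rw [Finset.sum_congr rfl fun ω hω => by rw [(mem_saws.1 hω).1], Finset.sum_const, card_saws, count_zero]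
    simp
  · have hyi : y⁻¹ ≤ 1 := inv_le_one_of_one_le₀ hy
    have hd : (0 : ℝ) ≤ 2 * d := by positivity
    calc ∑ ω ∈ saws (d + 1) (n + 1), y ^ (ω (n + 1) 0) ≤ (y + 2 * d + y⁻¹) * (y + 2 * d) ^ n := sum_saws_zpow_le d hy n
      _ ≤ (2 * (y + 2 * d)) * (y + 2 * d) ^ n := by
          refine mul_le_mul_of_nonneg_right ?_ (by positivity); linarith
      _ = 2 * (y + 2 * d) ^ (n + 1) := by ring

/-! ### The pulled-bridge free energy: `y ≤ e^{λ_B(y)} ≤ y + 2d` -/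

/-- The span of a bridge is its (nonnegative) final force coordinate. [cite: MadrasSlade1993, Definition 3.1.2] -/
private theorem apply_zero_nonneg_of_mem_bridges_env {d n : ℕ} {ω : ℕ → Site (d + 1)} (hω : ω ∈ bridges (d + 1) n) :
    0 ≤ ω n 0 := by
  obtain ⟨hs, hbr⟩ := mem_bridges.1 hω
  have h0 : ω 0 = 0 := (mem_saws.1 hs).1
  rcases Nat.eq_zero_or_pos n with rfl | hn
  · rw [h0]; rfl
  · have := (hbr n hn le_rfl).1
    rw [h0, Pi.zero_apply] at this
    exact this.le

/-- **`Z^B_n(y) ≤ 2(y + 2d)ⁿ`** on `ℤ^{d+1}` for every `y ≥ 1`, every `n`, every `d` (bridges are self-avoiding walks and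
`y^{span} = y^{ω(n)·e₀}`). [cite: Beaton2015, §3 (bridges, Z^B_n)] [cite: JansevanRensburgWhittington2013, §3.2 eq. (3.12) (arXiv v4 p. 9)] -/
theorem pulledBridgeZ_le_two_mul_pow (d n : ℕ) {y : ℝ} (hy : 1 ≤ y) :
    pulledBridgeZ (d + 1) n y ≤ 2 * (y + 2 * d) ^ n := by
  classical
  have hy0 : 0 < y := zero_lt_one.trans_le hy
  rw [pulledBridgeZ_eq_sum_bridges]
  have hsub : bridges (d + 1) n ⊆ saws (d + 1) n := fun ω hω => (mem_bridges.1 hω).1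
  calc ∑ ω ∈ bridges (d + 1) n, y ^ (ω n 0).toNat = ∑ ω ∈ bridges (d + 1) n, y ^ (ω n 0) := by
        refine Finset.sum_congr rfl fun ω hω => ?_
        rw [← zpow_natCast, Int.toNat_of_nonneg (apply_zero_nonneg_of_mem_bridges_env hω)]
    _ ≤ ∑ ω ∈ saws (d + 1) n, y ^ (ω n 0) := Finset.sum_le_sum_of_subset_of_nonneg hsub fun ω _ _ => (zpow_pos hy0 _).le
    _ ≤ 2 * (y + 2 * d) ^ n := sum_saws_zpow_le_two_mul d n hy

/-- ★★ **`λ_B(y) ≤ log(y + 2d)` on `ℤ^{d+1}` for every `y ≥ 1` and every `d`** (Fekete transfer of `Z^B_n ≤ 2(y + 2d)ⁿ`).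
The tree's planar `pulledBridgeFreeEnergy_le_log_add_two` is the case `d + 1 = 2`. [cite: JansevanRensburgWhittington2013, §3.2 eq. (3.12) (arXiv v4 p. 9)] -/
theorem pulledBridgeFreeEnergy_le_log_add (d : ℕ) {y : ℝ} (hy : 1 ≤ y) :
    pulledBridgeFreeEnergy (d + 1) y ≤ Real.log (y + 2 * d) := by
  have hy0 : 0 < y := zero_lt_one.trans_le hy
  exact pulledBridgeFreeEnergy_le_log_of_geometric d hy0 (by norm_num) (by positivity)
    fun N => pulledBridgeZ_le_two_mul_pow d N hy

/-- ★★ **`e^{λ_B(y)} ≤ y + 2d`** on `ℤ^{d+1}` for every `y ≥ 1`, every `d`: the first-order truncation `y + c_1^{(d)}` of the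
large-force expansion bounds `e^{λ_B}` from above at ALL forces. [cite: JansevanRensburgWhittington2013, §3.2 eq. (3.12) and Theorem 8 (arXiv v4 pp. 9, 11)] -/
theorem exp_pulledBridgeFreeEnergy_le_add (d : ℕ) {y : ℝ} (hy : 1 ≤ y) :
    Real.exp (pulledBridgeFreeEnergy (d + 1) y) ≤ y + 2 * d := by
  have h := Real.exp_le_exp.2 (pulledBridgeFreeEnergy_le_log_add d hy)
  rwa [Real.exp_log (by positivity)] at h

/-- ★★ **The dimension-uniform first-order sandwich**: `y ≤ e^{λ_B(y)} ≤ y + 2d` on `ℤ^{d+1}`, for every `y ≥ 1` and every `d`.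
[cite: JansevanRensburgWhittington2013, §3.2 eq. (3.12) (arXiv v4 p. 9: «max{log μ_d, log y} ≤ λ(y)»)] -/
theorem exp_pulledBridgeFreeEnergy_mem_Icc (d : ℕ) {y : ℝ} (hy : 1 ≤ y) :
    Real.exp (pulledBridgeFreeEnergy (d + 1) y) ∈ Set.Icc y (y + 2 * d) := by
  have hy0 : 0 < y := zero_lt_one.trans_le hy
  refine ⟨?_, exp_pulledBridgeFreeEnergy_le_add d hy⟩
  have h := Real.exp_le_exp.2 (log_le_pulledBridgeFreeEnergy_zd d hy0)
  rwa [Real.exp_log hy0] at h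

/-- `0 ≤ e^{λ_B(y)} − y ≤ c_1^{(d)} = 2d`: the excess of `e^{λ_B}` over the bare force is between `0` and the first large-force
coefficient, for every `y ≥ 1`. [cite: JansevanRensburgWhittington2013, §3.2 Theorem 8 (arXiv v4 p. 11)] -/
theorem exp_pulledBridgeFreeEnergy_sub_le_largeForceCoeffZd_one (d : ℕ) {y : ℝ} (hy : 1 ≤ y) :
    0 ≤ Real.exp (pulledBridgeFreeEnergy (d + 1) y) - y ∧
      Real.exp (pulledBridgeFreeEnergy (d + 1) y) - y ≤ (largeForceCoeffZd d 1 : ℝ) := by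
  obtain ⟨h1, h2⟩ := exp_pulledBridgeFreeEnergy_mem_Icc d hy
  rw [largeForceCoeffZd_at_one]
  push_cast
  exact ⟨by linarith, by linarith⟩

/-- `λ_B(y) − log y ≤ log(1 + 2d/y) ≤ 2d/y` for `y ≥ 1`: an explicit, dimension-uniform rate for `λ_B(y) − log y → 0`.
[cite: JansevanRensburgWhittington2013, §3.2 eq. (3.12) (arXiv v4 p. 9)] -/
theorem pulledBridgeFreeEnergy_sub_log_le (d : ℕ) {y : ℝ} (hy : 1 ≤ y) :
    pulledBridgeFreeEnergy (d + 1) y - Real.log y ≤ 2 * d / y := by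
  have hy0 : 0 < y := zero_lt_one.trans_le hy
  have h := pulledBridgeFreeEnergy_le_log_add d hy
  have hlog : Real.log (y + 2 * d) - Real.log y ≤ 2 * d / y := by
    rw [← Real.log_div (by positivity) hy0.ne', add_div, div_self hy0.ne']
    have h1 : (0 : ℝ) ≤ 2 * d / y := by positivity
    calc Real.log (1 + 2 * d / y) ≤ 1 + 2 * d / y - 1 := Real.log_le_sub_one_of_pos (by positivity)
      _ = 2 * d / y := by ring
  linarith

end Literature.Probability.RandomPlanarGeometry.SAW.Zd
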